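import Mathlib
import Summits.Ventures.PercRepro2.Defs
import Summits.Ventures.PercRepro2.Independence
import Summits.Ventures.PercRepro2.Harris
import Summits.Ventures.PercRepro2.Graph
import Summits.Ventures.PercRepro2.Events
import Summits.Ventures.PercRepro2.Induced
import Summits.Ventures.PercRepro2.BHK
import Summits.Ventures.PercRepro2.BHKEvents

/-!
# BHK06 Theorem 1.5, the mixed instances (mine-a g6; proofs/MINEA-MARKEREDGE.md §3)

Van den Berg–Häggström–Kahn (2006), Theorem 1.5: conditioned on `s ↮ t`, two bounded functions of
`(C_s, C_t)` that are each increasing in `C_s` and decreasing in `C_t` are positively correlated.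
The tree has the two boundary cases — `bhk_same_cluster` (both functions of `C_s`, BHK 1.3) and
`bhk_cross_cluster` (one of `C_s`, one of `C_t`, BHK 1.4) — and proves the second from the first by
conditioning on `C_s` (`delClusterProb`, the tower identity `prob_clusterIn_inter_eq_expect`).
The same argument gives the mixed instances used by the marker-edge reduction of row 2′RB:

* `bhk_mixed_cluster`: `P(C_s ∈ 𝓤, Q) · P(C_s ∈ 𝓥, C_t ∉ 𝓦, Q) ≤ P(C_s ∈ 𝓤 ∩ 𝓥, C_t ∉ 𝓦, Q) · P(Q)`
  (`f = 1_𝓤(C_s)`, `g = 1_𝓥(C_s) · 1_{𝓦ᶜ}(C_t)`);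
* `bhk_mixed_cluster_cross`:
  `P(C_s ∈ 𝓥, C_t ∉ 𝓦, C_t ∈ 𝓤′, Q) · P(Q) ≤ P(C_t ∈ 𝓤′, Q) · P(C_s ∈ 𝓥, C_t ∉ 𝓦, Q)`
  (`f = 1 − 1_{𝓤′}(C_t)`, the same `g`; Harris in `G ∖ W̄` for the two decreasing events of `C_t`).

Here `Q = {s ↮ t}` and `𝓤, 𝓥, 𝓦, 𝓤′` are up-sets of vertex sets.
-/

namespace Summit.Ventures.PercRepro2

namespace BHKMixed

section Mixed

variable {V : Type*} {E : Type*} [Fintype E] [DecidableEq E] [Fintype V] [DecidableEq V]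
  {R : Type*} [CommRing R] [LinearOrder R] [IsStrictOrderedRing R]

omit [Fintype E] [DecidableEq E] [Fintype V] [DecidableEq V] in
/-- The cluster events of two families intersect to the event of the intersection. -/
lemma clusterInEvent_inter (ends : E → Sym2 V) (x : V) (𝓤 𝓥 : Set (Set V)) :
    clusterInEvent ends x 𝓤 ∩ clusterInEvent ends x 𝓥 = clusterInEvent ends x (𝓤 ∩ 𝓥) := by
  ext ω
  simp only [Set.mem_inter_iff, mem_clusterInEvent]

omit [Fintype E] [DecidableEq E] [Fintype V] [DecidableEq V] in
/-- The complements of two cluster events intersect to the complement of the union. -/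
lemma compl_clusterInEvent_inter (ends : E → Sym2 V) (x : V) (𝓦 𝓤 : Set (Set V)) :
    (clusterInEvent ends x 𝓦)ᶜ ∩ (clusterInEvent ends x 𝓤)ᶜ = (clusterInEvent ends x (𝓦 ∪ 𝓤))ᶜ := by
  ext ω
  simp only [Set.mem_inter_iff, Set.mem_compl_iff, mem_clusterInEvent, Set.mem_union, not_or]

omit [Fintype E] [DecidableEq E] [Fintype V] [DecidableEq V] in
/-- `delConfig` is monotone in the configuration. -/
lemma delConfig_mono_config (ends : E → Sym2 V) (W : Set V) {ω ω' : Config E} (h : ω ≤ ω') :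
    delConfig ends W ω ≤ delConfig ends W ω' := by
  intro e
  by_cases he : e ∈ touches ends W
  · rw [delConfig_apply_of_mem he, delConfig_apply_of_mem he]
  · rw [delConfig_apply_of_notMem he, delConfig_apply_of_notMem he]
    exact h e

omit [Fintype V] [DecidableEq V] [LinearOrder R] [IsStrictOrderedRing R] in
/-- `E[1_𝓔(C_s) · 1_Q] = P(C_s ∈ 𝓔, Q)`. -/
lemma expect_indicator_clusterIn_mul (p : E → R) (ends : E → Sym2 V) (s t : V) (𝓔 : Set (Set V)) :
    expect p (fun ω => 𝓔.indicator 1 (cluster ends ω s) * ((connEvent ends s t)ᶜ).indicator 1 ω) =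
      prob p (clusterInEvent ends s 𝓔 ∩ (connEvent ends s t)ᶜ) := by
  rw [prob_eq_expect_indicator]
  unfold expect
  refine Finset.sum_congr rfl fun ω _ => ?_
  congr 1
  rw [indicator_inter_one]
  rfl

omit [DecidableEq V] in
/-- `E[1_𝓔(C_s) · (1 − g_𝓦(C_s)) · 1_Q] = P(C_s ∈ 𝓔, C_t ∉ 𝓦, Q)` with `g_𝓦 = delClusterProb`. -/
lemma expect_indicator_mul_one_sub_del (p : E → R) (ends : E → Sym2 V) (s t : V)
    (𝓔 𝓦 : Set (Set V)) :
    expect p (fun ω => 𝓔.indicator 1 (cluster ends ω s) *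
        (1 - delClusterProb p ends t 𝓦 (cluster ends ω s)) * ((connEvent ends s t)ᶜ).indicator 1 ω) =
      prob p (clusterInEvent ends s 𝓔 ∩ (clusterInEvent ends t 𝓦)ᶜ ∩ (connEvent ends s t)ᶜ) := by
  have h1 := expect_indicator_clusterIn_mul p ends s t 𝓔
  have h2 := prob_clusterIn_inter_eq_expect p ends s t 𝓔 𝓦
  have hsplit : prob p (clusterInEvent ends s 𝓔 ∩ clusterInEvent ends t 𝓦 ∩ (connEvent ends s t)ᶜ) +
      prob p (clusterInEvent ends s 𝓔 ∩ (clusterInEvent ends t 𝓦)ᶜ ∩ (connEvent ends s t)ᶜ) =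
      prob p (clusterInEvent ends s 𝓔 ∩ (connEvent ends s t)ᶜ) := by
    rw [Set.inter_right_comm _ (clusterInEvent ends t 𝓦),
      Set.inter_right_comm _ (clusterInEvent ends t 𝓦)ᶜ]
    exact prob_inter_add_prob_inter_compl p _ _
  have e : (fun ω => 𝓔.indicator 1 (cluster ends ω s) *
      (1 - delClusterProb p ends t 𝓦 (cluster ends ω s)) * ((connEvent ends s t)ᶜ).indicator 1 ω) =
      (fun ω => 𝓔.indicator 1 (cluster ends ω s) * ((connEvent ends s t)ᶜ).indicator 1 ω) -
        (fun ω => 𝓔.indicator 1 (cluster ends ω s) * delClusterProb p ends t 𝓦 (cluster ends ω s) *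
          ((connEvent ends s t)ᶜ).indicator 1 ω) := by
    funext ω
    simp only [Pi.sub_apply]
    ring
  rw [e, expect_sub, h1, ← h2]
  linarith [hsplit]

/-- **BHK06 Theorem 1.5, same-side instance**: for up-sets `𝓤, 𝓥` (events of `C_s`) and an
up-set `𝓦` (event of `C_t`),
`P(C_s ∈ 𝓤, Q) · P(C_s ∈ 𝓥, C_t ∉ 𝓦, Q) ≤ P(C_s ∈ 𝓤 ∩ 𝓥, C_t ∉ 𝓦, Q) · P(Q)`. -/
theorem bhk_mixed_cluster (p : E → R) (hp : IsProbVec p) (ends : E → Sym2 V) (s t : V)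
    {𝓤 𝓥 𝓦 : Set (Set V)} (h𝓤 : IsUpperSet 𝓤) (h𝓥 : IsUpperSet 𝓥) (h𝓦 : IsUpperSet 𝓦) :
    prob p (clusterInEvent ends s 𝓤 ∩ (connEvent ends s t)ᶜ) *
        prob p (clusterInEvent ends s 𝓥 ∩ (clusterInEvent ends t 𝓦)ᶜ ∩ (connEvent ends s t)ᶜ) ≤
      prob p (clusterInEvent ends s (𝓤 ∩ 𝓥) ∩ (clusterInEvent ends t 𝓦)ᶜ ∩ (connEvent ends s t)ᶜ) *
        prob p (connEvent ends s t)ᶜ := by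
  classical
  set g := delClusterProb p ends t 𝓦 with hg
  have hg_anti : Antitone g := delClusterProb_anti p hp ends t h𝓦
  have hg1 : ∀ W, g W ≤ 1 := delClusterProb_le_one p hp ends t 𝓦
  have hF₁ : Monotone (𝓤.indicator (1 : Set V → R)) := monotone_indicator_one_of_isUpperSet h𝓤
  have hV : Monotone (𝓥.indicator (1 : Set V → R)) := monotone_indicator_one_of_isUpperSet h𝓥
  have hF₂ : Monotone (fun W => 𝓥.indicator (1 : Set V → R) W * (1 - g W)) := by
    intro W W' h
    simp only
    refine mul_le_mul (hV h) (by linarith [hg_anti h]) (by linarith [hg1 W])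
      (Set.indicator_apply_nonneg fun _ => zero_le_one)
  have hF₁0 : ∀ W, 0 ≤ 𝓤.indicator (1 : Set V → R) W :=
    fun W => Set.indicator_apply_nonneg fun _ => zero_le_one
  have hF₂0 : ∀ W, 0 ≤ 𝓥.indicator (1 : Set V → R) W * (1 - g W) := fun W =>
    mul_nonneg (Set.indicator_apply_nonneg fun _ => zero_le_one) (by linarith [hg1 W])
  have key := bhk_same_cluster p hp ends s t hF₁ hF₂ hF₁0 hF₂0
  rw [expect_indicator_clusterIn_mul] at key
  have e2 : expect p (fun ω => 𝓥.indicator 1 (cluster ends ω s) * (1 - g (cluster ends ω s)) *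
      ((connEvent ends s t)ᶜ).indicator 1 ω) =
      prob p (clusterInEvent ends s 𝓥 ∩ (clusterInEvent ends t 𝓦)ᶜ ∩ (connEvent ends s t)ᶜ) :=
    expect_indicator_mul_one_sub_del p ends s t 𝓥 𝓦
  have e3 : expect p (fun ω => 𝓤.indicator 1 (cluster ends ω s) *
      (𝓥.indicator 1 (cluster ends ω s) * (1 - g (cluster ends ω s))) *
      ((connEvent ends s t)ᶜ).indicator 1 ω) =
      prob p (clusterInEvent ends s (𝓤 ∩ 𝓥) ∩ (clusterInEvent ends t 𝓦)ᶜ ∩ (connEvent ends s t)ᶜ) := by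
    rw [← expect_indicator_mul_one_sub_del p ends s t (𝓤 ∩ 𝓥) 𝓦]
    congr 1
    funext ω
    rw [Set.inter_indicator_one, Pi.mul_apply]
    ring
  rw [e2, e3] at key
  exact key

omit [Fintype V] [DecidableEq V] in
/-- **Harris in `G ∖ W̄`**: the two decreasing events `{C_t ∉ 𝓦}`, `{C_t ∉ 𝓤}` of the deleted graph
are positively correlated: `1 − g_{𝓦 ∪ 𝓤} ≥ (1 − g_𝓦)(1 − g_𝓤)` pointwise in `W`. -/
lemma one_sub_delClusterProb_union (p : E → R) (hp : IsProbVec p) (ends : E → Sym2 V) (t : V)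
    {𝓦 𝓤 : Set (Set V)} (h𝓦 : IsUpperSet 𝓦) (h𝓤 : IsUpperSet 𝓤) (W : Set V) :
    (1 - delClusterProb p ends t 𝓦 W) * (1 - delClusterProb p ends t 𝓤 W) ≤
      1 - delClusterProb p ends t (𝓦 ∪ 𝓤) W := by
  classical
  have hlow : ∀ {𝓔 : Set (Set V)}, IsUpperSet 𝓔 →
      IsLowerSet ({ω : Config E | cluster ends (delConfig ends W ω) t ∈ 𝓔}ᶜ) := by
    intro 𝓔 h𝓔 ω ω' hle hω hω'
    exact hω (h𝓔 (cluster_mono (delConfig_mono_config ends W hle) t) hω')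
  have h := prob_mul_prob_le_prob_inter_of_isLowerSet hp (hlow h𝓦) (hlow h𝓤)
  have e : {ω : Config E | cluster ends (delConfig ends W ω) t ∈ 𝓦}ᶜ ∩
      {ω : Config E | cluster ends (delConfig ends W ω) t ∈ 𝓤}ᶜ =
      {ω : Config E | cluster ends (delConfig ends W ω) t ∈ 𝓦 ∪ 𝓤}ᶜ := by
    ext ω
    simp only [Set.mem_inter_iff, Set.mem_compl_iff, Set.mem_setOf_eq, Set.mem_union, not_or]
  rw [e, prob_compl, prob_compl, prob_compl] at h
  exact h

/-- **BHK06 Theorem 1.5, cross instance**: for up-sets `𝓥` (event of `C_s`) and `𝓦, 𝓤′`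
(events of `C_t`),
`P(C_s ∈ 𝓥, C_t ∉ 𝓦, C_t ∈ 𝓤′, Q) · P(Q) ≤ P(C_t ∈ 𝓤′, Q) · P(C_s ∈ 𝓥, C_t ∉ 𝓦, Q)`. -/
theorem bhk_mixed_cluster_cross (p : E → R) (hp : IsProbVec p) (ends : E → Sym2 V) (s t : V)
    {𝓥 𝓦 𝓤' : Set (Set V)} (h𝓥 : IsUpperSet 𝓥) (h𝓦 : IsUpperSet 𝓦) (h𝓤' : IsUpperSet 𝓤') :
    prob p (clusterInEvent ends s 𝓥 ∩ (clusterInEvent ends t 𝓦)ᶜ ∩ clusterInEvent ends t 𝓤' ∩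
        (connEvent ends s t)ᶜ) * prob p (connEvent ends s t)ᶜ ≤
      prob p (clusterInEvent ends t 𝓤' ∩ (connEvent ends s t)ᶜ) *
        prob p (clusterInEvent ends s 𝓥 ∩ (clusterInEvent ends t 𝓦)ᶜ ∩ (connEvent ends s t)ᶜ) := by
  classical
  set g₁ := delClusterProb p ends t 𝓦 with hg₁
  set g₂ := delClusterProb p ends t 𝓤' with hg₂
  set g₁₂ := delClusterProb p ends t (𝓦 ∪ 𝓤') with hg₁₂
  have hg₁_anti : Antitone g₁ := delClusterProb_anti p hp ends t h𝓦
  have hg₂_anti : Antitone g₂ := delClusterProb_anti p hp ends t h𝓤'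
  have hg₁1 : ∀ W, g₁ W ≤ 1 := delClusterProb_le_one p hp ends t 𝓦
  have hg₂1 : ∀ W, g₂ W ≤ 1 := delClusterProb_le_one p hp ends t 𝓤'
  have hg₂0 : ∀ W, 0 ≤ g₂ W := delClusterProb_nonneg p hp ends t 𝓤'
  have hV : Monotone (𝓥.indicator (1 : Set V → R)) := monotone_indicator_one_of_isUpperSet h𝓥
  have hV0 : ∀ W, 0 ≤ 𝓥.indicator (1 : Set V → R) W :=
    fun W => Set.indicator_apply_nonneg fun _ => zero_le_one
  set Qc := (connEvent ends s t)ᶜ with hQc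
  set X := prob p (clusterInEvent ends s 𝓥 ∩ (clusterInEvent ends t 𝓦)ᶜ ∩ Qc) with hX
  -- (1) the joint event as an expectation, bounded by Harris in `G ∖ W̄`
  have hsplit : prob p (clusterInEvent ends s 𝓥 ∩ (clusterInEvent ends t 𝓦)ᶜ ∩ clusterInEvent ends t 𝓤' ∩ Qc) +
      prob p (clusterInEvent ends s 𝓥 ∩ (clusterInEvent ends t 𝓦)ᶜ ∩ (clusterInEvent ends t 𝓤')ᶜ ∩ Qc) = X := by
    rw [Set.inter_right_comm _ (clusterInEvent ends t 𝓤'),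
      Set.inter_right_comm _ (clusterInEvent ends t 𝓤')ᶜ]
    exact prob_inter_add_prob_inter_compl p _ _
  have hcompl : prob p (clusterInEvent ends s 𝓥 ∩ (clusterInEvent ends t 𝓦)ᶜ ∩
      (clusterInEvent ends t 𝓤')ᶜ ∩ Qc) =
      expect p (fun ω => 𝓥.indicator 1 (cluster ends ω s) * (1 - g₁₂ (cluster ends ω s)) *
        Qc.indicator 1 ω) := by
    rw [Set.inter_assoc (clusterInEvent ends s 𝓥), compl_clusterInEvent_inter,
      expect_indicator_mul_one_sub_del]
  have hXe : X = expect p (fun ω => 𝓥.indicator 1 (cluster ends ω s) * (1 - g₁ (cluster ends ω s)) *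
      Qc.indicator 1 ω) := (expect_indicator_mul_one_sub_del p ends s t 𝓥 𝓦).symm
  have hjoint : prob p (clusterInEvent ends s 𝓥 ∩ (clusterInEvent ends t 𝓦)ᶜ ∩ clusterInEvent ends t 𝓤' ∩ Qc) ≤
      expect p (fun ω => g₂ (cluster ends ω s) * (𝓥.indicator 1 (cluster ends ω s) *
        (1 - g₁ (cluster ends ω s))) * Qc.indicator 1 ω) := by
    have : prob p (clusterInEvent ends s 𝓥 ∩ (clusterInEvent ends t 𝓦)ᶜ ∩ clusterInEvent ends t 𝓤' ∩ Qc) =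
        expect p (fun ω => 𝓥.indicator 1 (cluster ends ω s) *
          (g₁₂ (cluster ends ω s) - g₁ (cluster ends ω s)) * Qc.indicator 1 ω) := by
      have hj : prob p (clusterInEvent ends s 𝓥 ∩ (clusterInEvent ends t 𝓦)ᶜ ∩
          clusterInEvent ends t 𝓤' ∩ Qc) = X - prob p (clusterInEvent ends s 𝓥 ∩
          (clusterInEvent ends t 𝓦)ᶜ ∩ (clusterInEvent ends t 𝓤')ᶜ ∩ Qc) := by linarith [hsplit]
      rw [hj, hcompl, hXe, ← expect_sub]
      congr 1
      funext ω
      simp only [Pi.sub_apply]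
      ring
    rw [this]
    refine expect_mono hp fun ω => ?_
    have hW := one_sub_delClusterProb_union p hp ends t h𝓦 h𝓤' (cluster ends ω s)
    have hi : 0 ≤ 𝓥.indicator (1 : Set V → R) (cluster ends ω s) * Qc.indicator 1 ω :=
      mul_nonneg (hV0 _) (Set.indicator_apply_nonneg fun _ => zero_le_one)
    have hcore : g₁₂ (cluster ends ω s) - g₁ (cluster ends ω s) ≤
        g₂ (cluster ends ω s) * (1 - g₁ (cluster ends ω s)) := by
      nlinarith [hW]
    nlinarith [mul_le_mul_of_nonneg_left hcore hi]
  -- (2) BHK 1.3 with `F₁ = 1 − g₂`, `F₂ = 1_𝓥 (1 − g₁)`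
  have hF₁ : Monotone (fun W => 1 - g₂ W) := fun W W' h => by
    simp only
    linarith [hg₂_anti h]
  have hF₂ : Monotone (fun W => 𝓥.indicator (1 : Set V → R) W * (1 - g₁ W)) := by
    intro W W' h
    simp only
    exact mul_le_mul (hV h) (by linarith [hg₁_anti h]) (by linarith [hg₁1 W]) (hV0 W')
  have hF₁0 : ∀ W, 0 ≤ 1 - g₂ W := fun W => by linarith [hg₂1 W]
  have hF₂0 : ∀ W, 0 ≤ 𝓥.indicator (1 : Set V → R) W * (1 - g₁ W) := fun W =>
    mul_nonneg (hV0 W) (by linarith [hg₁1 W])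
  have key := bhk_same_cluster p hp ends s t hF₁ hF₂ hF₁0 hF₂0
  have eU : expect p (fun ω => (1 - g₂ (cluster ends ω s)) * Qc.indicator 1 ω) =
      prob p Qc - prob p (clusterInEvent ends t 𝓤' ∩ Qc) := by
    have eV := prob_clusterIn_inter_eq_expect p ends s t Set.univ 𝓤'
    simp only [Set.indicator_univ, Pi.one_apply, one_mul] at eV
    have eV' : clusterInEvent ends s Set.univ ∩ clusterInEvent ends t 𝓤' ∩ Qc =
        clusterInEvent ends t 𝓤' ∩ Qc := by
      ext ω; simp [clusterInEvent]
    rw [eV'] at eV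
    rw [eV, prob_eq_expect_indicator p Qc, ← expect_sub]
    congr 1
    funext ω
    simp only [Pi.sub_apply]
    ring
  have eProd : expect p (fun ω => (1 - g₂ (cluster ends ω s)) *
      (𝓥.indicator 1 (cluster ends ω s) * (1 - g₁ (cluster ends ω s))) * Qc.indicator 1 ω) =
      X - expect p (fun ω => g₂ (cluster ends ω s) * (𝓥.indicator 1 (cluster ends ω s) *
        (1 - g₁ (cluster ends ω s))) * Qc.indicator 1 ω) := by
    rw [hXe, ← expect_sub]
    congr 1
    funext ω
    simp only [Pi.sub_apply]
    ring
  rw [eU, ← hXe, eProd] at key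
  have hQ0 : 0 ≤ prob p Qc := prob_nonneg hp _
  nlinarith [key, hjoint, hQ0]

end Mixed

end BHKMixed

end Summit.Ventures.PercRepro2
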